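import Summits.NavierStokesRegularity.NavierStokesRegularity.Theorems.SqueezeCycleExtremalBiaxialitySubcriticalIffTypeIAncientLiouville
import Summits.NavierStokesRegularity.NavierStokesRegularity.Theorems.HubbleDynamoNoSelfExcitedDynamoOfTypeIAncientLiouville
import Summits.NavierStokesRegularity.NavierStokesRegularity.Theorems.HubbleDynamoNoSelfExcitedDynamoHardness
import Literature.Analysis.FluidPDE.HyperbolicDSSOrbit
import HarnessLib

/-!
# Crux `ExtremalBiaxialitySubcritical` (stmt-NavierStokesRegularity-11609): hardness certificate —
  the crux implies the catalogued open conjecture `TypeIDSSLiouvilleConjecture`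

Helper file for item `stmt-NavierStokesRegularity-11609` (lands `--supports` it; line
`recurrent-singular-bridge`, lead c26). The tree already certifies

* `LiouvilleConjectureNS → ExtremalBiaxialitySubcritical`
  (`extremalBiaxialitySubcritical_of_liouvilleConjectureNS`, the KNSS / Seregin–Šverák conjecture (L)
  is an UPPER bound for the crux), and
* `ExtremalBiaxialitySubcritical ↔ TypeIAncientLiouville`
  (`extremalBiaxialitySubcritical_iff_typeIAncientLiouville`, p139165: the crux IS the Type-I
  ancient Liouville statement on the KNSS-mild rate class).

This file adds the LOWER bound by a catalogued `@[conjecture]`: composing p139165 with route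
HubbleDynamo's bridge `TypeIAncientLiouville → NoSelfExcitedDynamo`
(`noSelfExcitedDynamo_of_typeIAncientLiouville'`) and its hardness certificate
`NoSelfExcitedDynamo → TypeIDSSLiouvilleConjecture`
(`typeIDSSLiouvilleConjecture_of_noSelfExcitedDynamo`) gives

* `typeIDSSLiouvilleConjecture_of_extremalBiaxialitySubcritical :
    ExtremalBiaxialitySubcritical → TypeIDSSLiouvilleConjecture`
  (canonical leaf `Summit.NavierStokesRegularity.NavierStokesRegularity.TypeIDSSLiouvilleConjecture`,
  Bradshaw–Tsai 2017 Open Problem 5.1 / Tsai GSM 192 Conjectures 8.8–8.9), together with the plain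
  and rotated `λ`-DSS statements for every `λ` and `R ∈ O(3)`;
* the same for the line's one open stub `RecurrentLiouville` (both route copies), via
  `typeIAncientLiouville_iff_recurrentLiouville`;
* contrapositives for the disprover: a failure of the conjecture, in particular ANY Type-I
  (rotated) DSS profile `IsTypeIDSSProfile c R u`, refutes the crux and the stub.

So the crux is sandwiched between two catalogued open conjectures,
`TypeIDSSLiouvilleConjecture ⇐ ExtremalBiaxialitySubcritical ⇐ LiouvilleConjectureNS`,
kernel-checked; every proof of the crux proves Bradshaw–Tsai's Open Problem 5.1 for all scaling
factors and rotations, and every Type-I DSS blow-up profile kills it.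
-/

noncomputable section

-- the theorem namespace of this sub-problem repeats `NavierStokesRegularity` (tree precedent)
set_option linter.dupNamespace false

namespace Summit.NavierStokesRegularity.NavierStokesRegularity.Theorems

open Literature.Analysis.FluidPDE
open Summit.NavierStokesRegularity.NavierStokesRegularity.Theses
open Summit.NavierStokesRegularity.NavierStokesRegularity.Theorems.NoSelfExcitedDynamo.Registered

/-- **The crux implies route HubbleDynamo's crux** `NoSelfExcitedDynamo` (pointwise-Type-I Liouville
for bounded ancient mild solutions): `ExtremalBiaxialitySubcritical → TypeIAncientLiouville`
(p139165) composed with `noSelfExcitedDynamo_of_typeIAncientLiouville'`. -/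
theorem noSelfExcitedDynamo_of_extremalBiaxialitySubcritical
    (h : SqueezeCycle.ExtremalBiaxialitySubcritical) : HubbleDynamo.NoSelfExcitedDynamo :=
  noSelfExcitedDynamo_of_typeIAncientLiouville'
    (extremalBiaxialitySubcritical_iff_typeIAncientLiouville.1 h)

/-- **Hardness certificate for the crux**: `ExtremalBiaxialitySubcritical` implies the catalogued
open conjecture `TypeIDSSLiouvilleConjecture` (canonical `@[conjecture]` leaf of this sub-problem;
Bradshaw–Tsai 2017, Open Problem 5.1; Tsai, Conjectures 8.8–8.9). So the crux is at least as hard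
as that conjecture. [cite: BradshawTsai2017CPDE, §5 Open Problem 5.1] -/
theorem typeIDSSLiouvilleConjecture_of_extremalBiaxialitySubcritical : Summit.NavierStokesRegularity.NavierStokesRegularity.Theses.SqueezeCycle.ExtremalBiaxialitySubcritical → Summit.NavierStokesRegularity.NavierStokesRegularity.TypeIDSSLiouvilleConjecture :=
  fun h => typeIDSSLiouvilleConjecture_of_noSelfExcitedDynamo
    (noSelfExcitedDynamo_of_extremalBiaxialitySubcritical h)

/-- The crux implies the plain Type-I `λ`-DSS Liouville statement `TypeIDSSLiouville λ` for every
scaling factor `λ`. [cite: BradshawTsai2017CPDE, §5 Open Problem 5.1] -/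
theorem typeIDSSLiouville_of_extremalBiaxialitySubcritical
    (h : SqueezeCycle.ExtremalBiaxialitySubcritical) (c : ℝ) : TypeIDSSLiouville c :=
  (typeIDSSLiouvilleConjecture_of_extremalBiaxialitySubcritical h c).1

/-- The crux implies the rotated Type-I `λ`-DSS Liouville statement `RotatedTypeIDSSLiouville λ R`
for every scaling factor `λ` and every `R ∈ O(3)`. [cite: BradshawTsai2017CPDE, §5 Open Problem 5.1] -/
theorem rotatedTypeIDSSLiouville_of_extremalBiaxialitySubcritical
    (h : SqueezeCycle.ExtremalBiaxialitySubcritical) (c : ℝ)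
    (R : EuclideanSpace ℝ (Fin 3) ≃ₗᵢ[ℝ] EuclideanSpace ℝ (Fin 3)) : RotatedTypeIDSSLiouville c R :=
  (typeIDSSLiouvilleConjecture_of_extremalBiaxialitySubcritical h c).2 R

/-- Contrapositive, for the disprover: a failure of `TypeIDSSLiouvilleConjecture` refutes the crux. -/
theorem not_extremalBiaxialitySubcritical_of_not_typeIDSSLiouvilleConjecture
    (h : ¬ Summit.NavierStokesRegularity.NavierStokesRegularity.TypeIDSSLiouvilleConjecture) :
    ¬ SqueezeCycle.ExtremalBiaxialitySubcritical :=
  fun hcrux => h (typeIDSSLiouvilleConjecture_of_extremalBiaxialitySubcritical hcrux)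

/-- In particular ANY Type-I (rotated) discretely self-similar profile — the object whose existence
is Bradshaw–Tsai's Open Problem 5.1 — refutes the crux. [cite: BradshawTsai2017CPDE, §5 Open Problem 5.1] -/
theorem not_extremalBiaxialitySubcritical_of_isTypeIDSSProfile {c : ℝ}
    {R : EuclideanSpace ℝ (Fin 3) ≃ₗᵢ[ℝ] EuclideanSpace ℝ (Fin 3)}
    {u : ℝ → EuclideanSpace ℝ (Fin 3) → EuclideanSpace ℝ (Fin 3)} (hu : IsTypeIDSSProfile c R u) :
    ¬ SqueezeCycle.ExtremalBiaxialitySubcritical :=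
  fun hcrux => hu.not_rotatedTypeIDSSLiouville
    (rotatedTypeIDSSLiouville_of_extremalBiaxialitySubcritical hcrux c R)

/-! ## The same certificate for the line's open stub `RecurrentLiouville` (item stmt-…-1589) -/

/-- **Hardness certificate for the stub / item 1589** (route SqueezeCycle's copy): the recurrent
Liouville statement implies `TypeIDSSLiouvilleConjecture`, through
`typeIAncientLiouville_iff_recurrentLiouville`. [cite: BradshawTsai2017CPDE, §5 Open Problem 5.1] -/
theorem typeIDSSLiouvilleConjecture_of_recurrentLiouville
    (h : SqueezeCycle.RecurrentLiouville) :
    Summit.NavierStokesRegularity.NavierStokesRegularity.TypeIDSSLiouvilleConjecture :=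
  typeIDSSLiouvilleConjecture_of_noSelfExcitedDynamo
    (noSelfExcitedDynamo_of_typeIAncientLiouville' (typeIAncientLiouville_iff_recurrentLiouville.2 h))

/-- The same for route RecurrentProfiles' copy of the statement (identical definiens; this is the
registered stub `stub_recurrentLiouville` of line `recurrent-singular-bridge`). [cite: BradshawTsai2017CPDE, §5 Open Problem 5.1] -/
theorem typeIDSSLiouvilleConjecture_of_recurrentLiouville'
    (h : RecurrentProfiles.RecurrentLiouville) :
    Summit.NavierStokesRegularity.NavierStokesRegularity.TypeIDSSLiouvilleConjecture :=
  typeIDSSLiouvilleConjecture_of_recurrentLiouville h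

/-- Contrapositive for the stub: a Type-I (rotated) DSS profile refutes `RecurrentLiouville`
(both copies, by `Iff.rfl` of the definiens). [cite: BradshawTsai2017CPDE, §5 Open Problem 5.1] -/
theorem not_recurrentLiouville_of_isTypeIDSSProfile {c : ℝ}
    {R : EuclideanSpace ℝ (Fin 3) ≃ₗᵢ[ℝ] EuclideanSpace ℝ (Fin 3)}
    {u : ℝ → EuclideanSpace ℝ (Fin 3) → EuclideanSpace ℝ (Fin 3)} (hu : IsTypeIDSSProfile c R u) :
    ¬ RecurrentProfiles.RecurrentLiouville :=
  fun h => hu.not_rotatedTypeIDSSLiouville ((typeIDSSLiouvilleConjecture_of_recurrentLiouville' h c).2 R)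

end Summit.NavierStokesRegularity.NavierStokesRegularity.Theorems

end
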